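import Summits.AnomalousDissipation.AnomalousDissipation.Theorems.MomentParityQuarticGateAxialCertTranslate
import Summits.AnomalousDissipation.AnomalousDissipation.Theorems.MomentParityQuarticGateAxialCertFunctionals
import Summits.AnomalousDissipation.AnomalousDissipation.Theorems.MomentParityQuarticGateDefectCone
import Summits.AnomalousDissipation.AnomalousDissipation.Theorems.MomentParityQuarticGateSignLemma

/-!
# Axial defect certificate for `MomentParity.QuarticGate` (stmt-AnomalousDissipation-11464),
# line `axis-sectors`, stub S3′ `stub_axialDefectCertificate`

THE LEVER AT ORDER 3 of the line `axis-sectors`. At a level `N` with no SHEAR-INVARIANT cubic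
Casimir (invariance under the finite shear group `H_L = {a : T³ | a 1 = 0, L • a = 0}`, `L > 3N`),
for a smooth shear-invariant force `f` and a level-`N` probability law `μ` with finite fourth
moments whose cylindrical statistics are `H_L`-invariant, there are finitely many level-`N` fields
`vₗ` and weights `cₗ ≥ 0` with `row_μ(p₃) + Σₗ cₗ {p₃, B_N}(vₗ) = 0` for EVERY homogeneous cubic
band test `p₃` — the plain certificate shape consumed by the surgery stub S4.

Proof (cone duality inside the invariant cubics, then de-averaging):

* transport every cubic band test to the coordinates of an orthonormal band basis `b` of `V_N`
  (`exists_bandBasis`, `polyGrad_transport`); `W :=` homogeneous cubics in `n` variables;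
* the row `ψ(P) = ∫ ⟨F(u), ∇p(u)⟩ dμ` and the Euler derivatives `ev_v(P) = {p, B_N}(v)` are linear
  functionals on `W` (`AxialCert.integrable_and_exists_cubicRowFunctional`,
  `AxialCert.exists_pointRowFunctional` of `…AxialCertFunctionals`);
* translations act: the translated family `(b(· + a), P)` is `(b, P ∘ ρ(a))`, its Euler
  derivative at `v` is `ev_{T_a v}(P)` with `T_a v = v(· - a)` and, for `a ∈ H_L`, its row equals
  the row of `P` (law invariance + covariance of the generator, `…AxialCertTranslate`);
* apply the abstract cone lemma `exists_conic_certificate` on `W` to `ψ` and the AVERAGED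
  functionals `ev'_v := Σ_{a ∈ H_L} ev_{T_a v}`: if `ev'_v(P) ≥ 0` for all level-`N` `v`, then the
  average `P̄ := Σ_{a ∈ H_L} P ∘ ρ(a)` has `{p̄, B_N} ≥ 0` on `V_N`, hence `≡ 0` (sign lemma
  `stub_signLemma`, S1), and `p̄` is `H_L`-invariant, hence `P̄ = 0` (no axial cubic Casimir); so
  `ev'_v(P) = ev_v(P̄) = 0` and `|H_L| ψ(P) = ψ(P̄) = 0`;
* the certificate `ψ + Σₗ cₗ ev'_{vₗ} = 0` is a plain certificate with the `|H_L|·M` atoms `T_a vₗ`.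
-/

-- `Summit.<Summit>.<Problem>` is the tree's mandated summit-side namespace (CONVENTIONS §2); for this
-- single-conjunct summit the two coincide, so the duplicate is deliberate.
set_option linter.dupNamespace false

namespace Summit.AnomalousDissipation.AnomalousDissipation.Theorems.MomentParityQuarticGate

open MeasureTheory Filter MvPolynomial
open scoped InnerProductSpace RealInnerProductSpace ENNReal
open Literature.Analysis.FunctionSpaces Literature.Analysis.FluidPDE
open Summit.AnomalousDissipation.AnomalousDissipation.Theses.MomentParity
open Summit.AnomalousDissipation.AnomalousDissipation.Theorems.QuarticGate.Negative

namespace AxialCert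

variable {N n : ℕ} {b : Fin n → UnitAddTorus (Fin 3) → EuclideanSpace ℝ (Fin 3)}

/-! ## The axial defect certificate in coordinates -/

/-- **The axial defect certificate in the coordinates of an orthonormal band basis.** Let `b` be an
orthonormal band basis of `V_N`, `L > 0`, and assume: no nonzero homogeneous cubic `P` in the
coordinates is at the same time `H_L`-invariant as an observable and a Casimir (`hCub`); the force
is smooth and shear invariant; the finite law `μ` is carried by level-`N` fields, has
`∫ ‖u‖⁴ < ∞`, and its statistics `((u, b_i(· + a)))_i` and `((u, b_i))_i` agree in law for
`a ∈ H_L`. Then there are finitely many level-`N` `vₗ` and `cₗ ≥ 0` with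
`∫ ⟨F(u), ∇p(u)⟩ dμ + Σₗ cₗ {p, B_N}(vₗ) = 0` for every homogeneous cubic `P`. [folklore] -/
theorem exists_axialDefectCertificate_coords {L : ℕ} (hb : ∀ i, IsBandTest N (b i))
    (hbo : ∀ i j, ∫ x, ⟪b i x, b j x⟫_ℝ = if i = j then (1 : ℝ) else 0)
    (hbs : ∀ u : Torus.energySpace (Fin 3), IsLevel N u →
      ∀ x, Torus.fourierTruncate N (u.1 : UnitAddTorus (Fin 3) → EuclideanSpace ℝ (Fin 3)) x =
        ∑ i, Torus.pairing u.1 (b i) • b i x)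
    (hL : 0 < L)
    (hCub : ∀ P : MvPolynomial (Fin n) ℝ, P.IsHomogeneous 3 →
      (∀ a : UnitAddTorus (Fin 3), a 1 = 0 → L • a = 0 → ∀ u : Torus.energySpace (Fin 3), IsLevel N u →
        eval (fun j => Torus.pairing u.1 (fun x => b j (x + a))) P =
          eval (fun j => Torus.pairing u.1 (b j)) P) →
      (∀ u : Torus.energySpace (Fin 3), IsLevel N u →
        Torus.nsGeneratorPairing (d := Fin 3) 0 0 u (polyGrad b P u) = 0) →
      ∀ u : Torus.energySpace (Fin 3), IsLevel N u → eval (fun j => Torus.pairing u.1 (b j)) P = 0)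
    (ν : ℝ) {f : UnitAddTorus (Fin 3) → EuclideanSpace ℝ (Fin 3)} (hf : Torus.IsSmooth f)
    (hfsym : ∀ a : UnitAddTorus (Fin 3), a 1 = 0 → ∀ x, f (x + a) = f x)
    (μ : Measure (Torus.energySpace (Fin 3))) [IsFiniteMeasure μ] (hμN : ∀ᵐ u ∂μ, IsLevel N u)
    (h4 : Integrable (fun u : Torus.energySpace (Fin 3) => ‖u‖ ^ 4) μ)
    (hsym : ∀ a : UnitAddTorus (Fin 3), a 1 = 0 → L • a = 0 →
      Measure.map (fun u : Torus.energySpace (Fin 3) => fun i =>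
          Torus.pairing u.1 (fun x => b i (x + a))) μ =
        Measure.map (fun u : Torus.energySpace (Fin 3) => fun i => Torus.pairing u.1 (b i)) μ) :
    ∃ (M : ℕ) (v : Fin M → Torus.energySpace (Fin 3)) (c : Fin M → ℝ),
      (∀ l, IsLevel N (v l)) ∧ (∀ l, 0 ≤ c l) ∧
      ∀ P : MvPolynomial (Fin n) ℝ, P.IsHomogeneous 3 →
        ∫ u, Torus.nsGeneratorPairing ν f u (polyGrad b P u) ∂μ +
          ∑ l, c l * Torus.nsGeneratorPairing (d := Fin 3) 0 0 (v l) (polyGrad b P (v l)) = 0 := by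
  classical
  haveI : FiniteDimensional ℝ ↥(homogeneousSubmodule (Fin n) ℝ 3) :=
    Module.Finite.iff_fg.mpr (homogeneousSubmodule_fg (Fin n) ℝ 3)
  -- the shear group as a finite set
  set H : Finset (UnitAddTorus (Fin 3)) := (finite_shearGroup L hL).toFinset with hHdef
  have hmemH : ∀ a, a ∈ H ↔ a 1 = 0 ∧ L • a = 0 := fun a => by
    rw [hHdef, Set.Finite.mem_toFinset]
    rfl
  have h0H : (0 : UnitAddTorus (Fin 3)) ∈ H := (hmemH 0).2 ⟨rfl, smul_zero _⟩
  have haddH : ∀ {a a' : UnitAddTorus (Fin 3)}, a ∈ H → a' ∈ H → a + a' ∈ H := by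
    intro a a' ha ha'
    obtain ⟨ha1, haL⟩ := (hmemH a).1 ha
    obtain ⟨ha1', haL'⟩ := (hmemH a').1 ha'
    refine (hmemH _).2 ⟨?_, ?_⟩
    · rw [Pi.add_apply, ha1, ha1', add_zero]
    · rw [smul_add, haL, haL', add_zero]
  have hsubH : ∀ {a a' : UnitAddTorus (Fin 3)}, a ∈ H → a' ∈ H → a - a' ∈ H := by
    intro a a' ha ha'
    obtain ⟨ha1, haL⟩ := (hmemH a).1 ha
    obtain ⟨ha1', haL'⟩ := (hmemH a').1 ha'
    refine (hmemH _).2 ⟨?_, ?_⟩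
    · rw [Pi.sub_apply, ha1, ha1', sub_zero]
    · rw [smul_sub, haL, haL', sub_zero]
  have hHcard : (0 : ℝ) < H.card := Nat.cast_pos.2 (Finset.card_pos.2 ⟨0, h0H⟩)
  -- the translation operator `T a v = v(· - a)` on level-`N` fields, through its coordinates
  have hT : ∀ (a : UnitAddTorus (Fin 3)) (v : Torus.energySpace (Fin 3)),
      ∃ v' : Torus.energySpace (Fin 3), IsLevel N v' ∧
        (fun i => Torus.pairing v'.1 (b i)) = (fun l => Torus.pairing v.1 (fun x => b l (x + a))) ∧
        ‖v'‖ ^ 2 = ∑ i, (Torus.pairing v.1 (fun x => b i (x + a))) ^ 2 ∧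
        (v'.1 : UnitAddTorus (Fin 3) → EuclideanSpace ℝ (Fin 3)) =ᵐ[volume]
          fun y => ∑ i, Torus.pairing v.1 (fun x => b i (x + a)) • b i y :=
    fun a v => exists_level_of_coords hb hbo _
  choose T hTl hTc _hTn hTae using hT
  -- the functionals
  obtain ⟨hint, ψ, hψ⟩ := integrable_and_exists_cubicRowFunctional hb hbo ν hf.integrable μ h4
  obtain ⟨ev, hev⟩ := exists_pointRowFunctional (n := n) (fun i => (hb i).1) 0
    (integrable_zero _ _ _ : Integrable (0 : UnitAddTorus (Fin 3) → EuclideanSpace ℝ (Fin 3)) volume)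
  have hψ0 : ∫ u, Torus.nsGeneratorPairing ν f u (polyGrad b (0 : MvPolynomial (Fin n) ℝ) u) ∂μ = 0 := by
    have h := hψ 0
    rw [map_zero, Submodule.coe_zero] at h
    exact h.symm
  have hev0 : ∀ v : Torus.energySpace (Fin 3),
      Torus.nsGeneratorPairing (d := Fin 3) 0 0 v (polyGrad b (0 : MvPolynomial (Fin n) ℝ) v) = 0 := by
    intro v
    have h := hev v 0
    rw [map_zero, Submodule.coe_zero] at h
    exact h.symm
  -- covariance of the Euler derivative and of the row under translations
  have hevT : ∀ (a : UnitAddTorus (Fin 3)) (v : Torus.energySpace (Fin 3)), IsLevel N v →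
      ∀ P : MvPolynomial (Fin n) ℝ,
      Torus.nsGeneratorPairing (d := Fin 3) 0 0 v (polyGrad b (bind₁ (fun j => ∑ l,
        C (∫ y, ⟪b j (y + a), b l y⟫_ℝ) * (X l : MvPolynomial (Fin n) ℝ)) P) v) =
      Torus.nsGeneratorPairing (d := Fin 3) 0 0 (T a v) (polyGrad b P (T a v)) := by
    intro a v hv P
    rw [show polyGrad b (bind₁ (fun j => ∑ l, C (∫ y, ⟪b j (y + a), b l y⟫_ℝ) *
        (X l : MvPolynomial (Fin n) ℝ)) P) v = polyGrad (fun l x => b l (x + a)) P v from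
      funext (polyGrad_bind₁_translate hb hbs a P v)]
    exact nsGeneratorPairing_polyGrad_translate hb hbo hbs 0 a (fun _ => rfl) hv (hTae a v) P
  have hrowT : ∀ a : UnitAddTorus (Fin 3), a 1 = 0 → ∀ u : Torus.energySpace (Fin 3), IsLevel N u →
      ∀ P : MvPolynomial (Fin n) ℝ,
      Torus.nsGeneratorPairing ν f u (polyGrad b (bind₁ (fun j => ∑ l,
        C (∫ y, ⟪b j (y + a), b l y⟫_ℝ) * (X l : MvPolynomial (Fin n) ℝ)) P) u) =
      Torus.nsGeneratorPairing ν f (T a u) (polyGrad b P (T a u)) := by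
    intro a ha u hu P
    rw [show polyGrad b (bind₁ (fun j => ∑ l, C (∫ y, ⟪b j (y + a), b l y⟫_ℝ) *
        (X l : MvPolynomial (Fin n) ℝ)) P) u = polyGrad (fun l x => b l (x + a)) P u from
      funext (polyGrad_bind₁_translate hb hbs a P u)]
    exact nsGeneratorPairing_polyGrad_translate hb hbo hbs ν a (hfsym a ha) hu (hTae a u) P
  -- (ii) the row is invariant under `P ↦ P ∘ ρ(a)`, `a ∈ H`
  have hii : ∀ a ∈ H, ∀ P : MvPolynomial (Fin n) ℝ,
      ∫ u, Torus.nsGeneratorPairing ν f u (polyGrad b (bind₁ (fun j => ∑ l,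
        C (∫ y, ⟪b j (y + a), b l y⟫_ℝ) * (X l : MvPolynomial (Fin n) ℝ)) P) u) ∂μ =
      ∫ u, Torus.nsGeneratorPairing ν f u (polyGrad b P u) ∂μ := by
    intro a ha P
    obtain ⟨ha1, haL⟩ := (hmemH a).1 ha
    obtain ⟨Q, -, hQ', -⟩ := exists_rowPoly hb hbo hbs ν f hf n b hb P P.totalDegree le_rfl
    have hQ : ∀ u : Torus.energySpace (Fin 3), IsLevel N u →
        Torus.nsGeneratorPairing ν f u (polyGrad b P u) = eval (fun i => Torus.pairing u.1 (b i)) Q :=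
      fun u hu => hQ' u hu
    calc ∫ u, Torus.nsGeneratorPairing ν f u (polyGrad b (bind₁ (fun j => ∑ l,
          C (∫ y, ⟪b j (y + a), b l y⟫_ℝ) * (X l : MvPolynomial (Fin n) ℝ)) P) u) ∂μ
        = ∫ u, eval (fun i => Torus.pairing u.1 (fun x => b i (x + a))) Q ∂μ := by
          refine integral_congr_ae ?_
          filter_upwards [hμN] with u hu
          rw [hrowT a ha1 u hu P, hQ _ (hTl a u), hTc a u]
      _ = ∫ u, eval (fun i => Torus.pairing u.1 (b i)) Q ∂μ :=
          integral_eval_translate_eq hb (hsym a ha1 haL) Q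
      _ = ∫ u, Torus.nsGeneratorPairing ν f u (polyGrad b P u) ∂μ := by
          refine integral_congr_ae ?_
          filter_upwards [hμN] with u hu
          rw [hQ u hu]
  -- the averaged polynomial `P̄ = Σ_{a ∈ H} P ∘ ρ(a)`: homogeneity, Euler derivative, invariance
  have hbarh : ∀ P : MvPolynomial (Fin n) ℝ, P.IsHomogeneous 3 →
      (∑ a ∈ H, bind₁ (fun j => ∑ l, C (∫ y, ⟪b j (y + a), b l y⟫_ℝ) *
        (X l : MvPolynomial (Fin n) ℝ)) P).IsHomogeneous 3 :=
    fun P hP => IsHomogeneous.sum _ _ _ fun a _ => isHomogeneous_bind₁_linear _ hP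
  have hbar_row : ∀ (ν' : ℝ) (f' : UnitAddTorus (Fin 3) → EuclideanSpace ℝ (Fin 3)), Torus.IsSmooth f' →
      ∀ (P : MvPolynomial (Fin n) ℝ) (v : Torus.energySpace (Fin 3)),
      Torus.nsGeneratorPairing ν' f' v (polyGrad b (∑ a ∈ H, bind₁ (fun j => ∑ l,
        C (∫ y, ⟪b j (y + a), b l y⟫_ℝ) * (X l : MvPolynomial (Fin n) ℝ)) P) v) =
      ∑ a ∈ H, Torus.nsGeneratorPairing ν' f' v (polyGrad b (bind₁ (fun j => ∑ l,
        C (∫ y, ⟪b j (y + a), b l y⟫_ℝ) * (X l : MvPolynomial (Fin n) ℝ)) P) v) := by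
    intro ν' f' hf' P v
    have h := nsGeneratorPairing_polyGrad_sum_smul ν' hf' (fun j => (hb j).1) H (fun _ => (1 : ℝ))
      (fun a => bind₁ (fun j => ∑ l, C (∫ y, ⟪b j (y + a), b l y⟫_ℝ) *
        (X l : MvPolynomial (Fin n) ℝ)) P) v
    simp only [one_smul, one_mul] at h
    exact h
  have hbar_ev : ∀ (P : MvPolynomial (Fin n) ℝ) (v : Torus.energySpace (Fin 3)), IsLevel N v →
      Torus.nsGeneratorPairing (d := Fin 3) 0 0 v (polyGrad b (∑ a ∈ H, bind₁ (fun j => ∑ l,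
        C (∫ y, ⟪b j (y + a), b l y⟫_ℝ) * (X l : MvPolynomial (Fin n) ℝ)) P) v) =
      ∑ a ∈ H, Torus.nsGeneratorPairing (d := Fin 3) 0 0 (T a v) (polyGrad b P (T a v)) := by
    intro P v hv
    rw [hbar_row 0 0 (Torus.isSmooth_const _) P v]
    exact Finset.sum_congr rfl fun a _ => hevT a v hv P
  have hbar_obs : ∀ (P : MvPolynomial (Fin n) ℝ) (a' : UnitAddTorus (Fin 3)), a' ∈ H →
      ∀ u : Torus.energySpace (Fin 3), IsLevel N u →
      eval (fun j => Torus.pairing u.1 (fun x => b j (x + a'))) (∑ a ∈ H, bind₁ (fun j => ∑ l,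
        C (∫ y, ⟪b j (y + a), b l y⟫_ℝ) * (X l : MvPolynomial (Fin n) ℝ)) P) =
      eval (fun j => Torus.pairing u.1 (b j)) (∑ a ∈ H, bind₁ (fun j => ∑ l,
        C (∫ y, ⟪b j (y + a), b l y⟫_ℝ) * (X l : MvPolynomial (Fin n) ℝ)) P) := by
    intro P a' ha' u hu
    rw [map_sum, map_sum]
    have hLt : ∀ a, eval (fun j => Torus.pairing u.1 (fun x => b j (x + a'))) (bind₁ (fun j => ∑ l,
        C (∫ y, ⟪b j (y + a), b l y⟫_ℝ) * (X l : MvPolynomial (Fin n) ℝ)) P) =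
        eval (fun j => Torus.pairing u.1 (fun x => b j (x + (a + a')))) P :=
      fun a => eval_translate_bind₁_translate hb hbo hbs hu (hTae a' u) a P
    have hRt : ∀ a, eval (fun j => Torus.pairing u.1 (b j)) (bind₁ (fun j => ∑ l,
        C (∫ y, ⟪b j (y + a), b l y⟫_ℝ) * (X l : MvPolynomial (Fin n) ℝ)) P) =
        eval (fun j => Torus.pairing u.1 (fun x => b j (x + a))) P :=
      fun a => eval_bind₁_translate hb hbs a P u
    simp only [hLt, hRt]
    refine Finset.sum_equiv (Equiv.addRight a') (fun a => ⟨fun ha => haddH ha ha', fun h => ?_⟩)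
      (fun a _ => rfl)
    have h' := hsubH h ha'
    rwa [Equiv.coe_addRight, add_sub_cancel_right] at h'
  -- the averaged Euler functionals
  have key : ∀ P : ↥(homogeneousSubmodule (Fin n) ℝ 3),
      (∀ x : {v : Torus.energySpace (Fin 3) // IsLevel N v}, 0 ≤ (∑ a ∈ H, ev (T a x.1)) P) →
      ψ P = 0 ∧ ∀ x : {v : Torus.energySpace (Fin 3) // IsLevel N v}, (∑ a ∈ H, ev (T a x.1)) P = 0 := by
    intro P hpos
    have hPh : P.1.IsHomogeneous 3 := P.2
    have hsumapply : ∀ x : {v : Torus.energySpace (Fin 3) // IsLevel N v},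
        (∑ a ∈ H, ev (T a x.1)) P =
          ∑ a ∈ H, Torus.nsGeneratorPairing (d := Fin 3) 0 0 (T a x.1) (polyGrad b P.1 (T a x.1)) := by
      intro x
      rw [LinearMap.sum_apply]
      exact Finset.sum_congr rfl fun a _ => hev _ _
    -- the Euler derivative of `P̄` is `≥ 0` on level-`N` fields, hence `0` (sign lemma)
    have h1 : ∀ v : Torus.energySpace (Fin 3), IsLevel N v →
        0 ≤ Torus.nsGeneratorPairing (d := Fin 3) 0 0 v (polyGrad b (∑ a ∈ H, bind₁ (fun j => ∑ l,
          C (∫ y, ⟪b j (y + a), b l y⟫_ℝ) * (X l : MvPolynomial (Fin n) ℝ)) P.1) v) := by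
      intro v hv
      rw [hbar_ev P.1 v hv, ← hsumapply ⟨v, hv⟩]
      exact hpos ⟨v, hv⟩
    have h2 : ∀ v : Torus.energySpace (Fin 3), IsLevel N v →
        Torus.nsGeneratorPairing (d := Fin 3) 0 0 v (polyGrad b (∑ a ∈ H, bind₁ (fun j => ∑ l,
          C (∫ y, ⟪b j (y + a), b l y⟫_ℝ) * (X l : MvPolynomial (Fin n) ℝ)) P.1) v) = 0 :=
      stub_signLemma N n b _ hb h1
    -- `P̄` is an `H`-invariant cubic Casimir, hence vanishes on level-`N` fields, hence is `0`
    have h3 : ∀ u : Torus.energySpace (Fin 3), IsLevel N u →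
        eval (fun j => Torus.pairing u.1 (b j)) (∑ a ∈ H, bind₁ (fun j => ∑ l,
          C (∫ y, ⟪b j (y + a), b l y⟫_ℝ) * (X l : MvPolynomial (Fin n) ℝ)) P.1) = 0 :=
      hCub _ (hbarh P.1 hPh) (fun a' ha1 haL u hu => hbar_obs P.1 a' ((hmemH a').2 ⟨ha1, haL⟩) u hu) h2
    have h4' : (∑ a ∈ H, bind₁ (fun j => ∑ l,
          C (∫ y, ⟪b j (y + a), b l y⟫_ℝ) * (X l : MvPolynomial (Fin n) ℝ)) P.1) = 0 := by
      refine MvPolynomial.funext fun x => ?_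
      obtain ⟨u, hul, huc, -, -⟩ := exists_level_of_coords hb hbo x
      rw [map_zero, ← h3 u hul, huc]
    refine ⟨?_, fun x => ?_⟩
    · -- `|H| ψ P = ψ P̄ = 0`
      have hsum : ∫ u, Torus.nsGeneratorPairing ν f u (polyGrad b (∑ a ∈ H, bind₁ (fun j => ∑ l,
            C (∫ y, ⟪b j (y + a), b l y⟫_ℝ) * (X l : MvPolynomial (Fin n) ℝ)) P.1) u) ∂μ =
          ∑ a ∈ H, ∫ u, Torus.nsGeneratorPairing ν f u (polyGrad b (bind₁ (fun j => ∑ l,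
            C (∫ y, ⟪b j (y + a), b l y⟫_ℝ) * (X l : MvPolynomial (Fin n) ℝ)) P.1) u) ∂μ := by
        rw [← integral_finsetSum H fun a _ => hint _ (isHomogeneous_bind₁_linear _ hPh)]
        exact integral_congr_ae (ae_of_all _ fun u => hbar_row ν f hf P.1 u)
      have hall : ∀ a ∈ H, ∫ u, Torus.nsGeneratorPairing ν f u (polyGrad b (bind₁ (fun j => ∑ l,
            C (∫ y, ⟪b j (y + a), b l y⟫_ℝ) * (X l : MvPolynomial (Fin n) ℝ)) P.1) u) ∂μ = ψ P :=
        fun a ha => by rw [hψ]; exact hii a ha P.1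
      rw [Finset.sum_congr rfl hall, Finset.sum_const, nsmul_eq_mul, h4', hψ0] at hsum
      exact (mul_eq_zero.1 hsum.symm).resolve_left hHcard.ne'
    · rw [hsumapply, ← hbar_ev P.1 x.1 x.2, h4']
      exact hev0 x.1
  obtain ⟨M, x, c, hc0, hcert⟩ := exists_conic_certificate
    (fun x : {v : Torus.energySpace (Fin 3) // IsLevel N v} => ∑ a ∈ H, ev (T a x.1)) ψ key
  -- de-averaging: the atoms are the translates `T a (x l)`, `(l, a) ∈ Fin M × H`
  set e : Fin M × ↥H ≃ Fin (M * H.card) :=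
    ((Equiv.refl (Fin M)).prodCongr H.equivFin).trans finProdFinEquiv with he
  refine ⟨M * H.card, fun k => T (e.symm k).2.1 (x (e.symm k).1).1, fun k => c (e.symm k).1,
    fun k => hTl _ _, fun k => hc0 _, fun P hP => ?_⟩
  have h := hcert ⟨P, hP⟩
  rw [hψ] at h
  have hre : (∑ k : Fin (M * H.card), c (e.symm k).1 *
        Torus.nsGeneratorPairing (d := Fin 3) 0 0 (T (e.symm k).2.1 (x (e.symm k).1).1)
          (polyGrad b P (T (e.symm k).2.1 (x (e.symm k).1).1))) =
      ∑ l, c l * (∑ a ∈ H, ev (T a (x l).1)) ⟨P, hP⟩ := by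
    rw [Fintype.sum_equiv e.symm _ (fun p : Fin M × ↥H => c p.1 *
        Torus.nsGeneratorPairing (d := Fin 3) 0 0 (T p.2.1 (x p.1).1)
          (polyGrad b P (T p.2.1 (x p.1).1))) (fun k => rfl), Fintype.sum_prod_type]
    refine Finset.sum_congr rfl fun l _ => ?_
    dsimp only
    rw [← Finset.mul_sum, LinearMap.sum_apply, ← Finset.sum_coe_sort H]
    refine congrArg (c l * ·) (Finset.sum_congr rfl fun a _ => ?_)
    rw [hev]
  beta_reduce
  rw [hre]
  exact h

end AxialCert

/-- **S3′ — THE LEVER AT ORDER 3: AXIAL DEFECT CERTIFICATE (the lead's S3 inside the invariant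
sub-algebra, de-averaged).** At a level `N` with no shear-invariant cubic Casimir (S2c at `N`, `H_L`-form), for a smooth
`G′`-invariant force and a level-`N` probability law `μ` with finite fourth moments and `H_L`-invariant
cylindrical statistics, `L > 3N`: finitely many level-`N` fields `vₗ` and weights `cₗ ≥ 0` with
`row_μ(p₃) + Σₗ cₗ {p₃,B_N}(vₗ) = 0` for every homogeneous cubic test `p₃` — the SAME certificate shape
the lead's S4 consumes.
Proof: expand the band tests in an orthonormal band basis `b` of `V_N` (`exists_bandBasis`,
`band_eq_sum_smul`, `pairing_band_eq_sum`), which transports `(g, P)` to `(b, P ∘ G)` with the same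
differential field (`polyGrad_transport`) and keeps homogeneity; in these coordinates the statement
is `AxialCert.exists_axialDefectCertificate_coords` (cone duality `exists_conic_certificate` for the
row functional against the `H_L`-AVERAGED Euler-derivative functionals, whose nonnegativity cone is
trivial by the sign lemma `stub_signLemma` and the absence of `H_L`-invariant cubic Casimirs; the
averaged certificate is a plain certificate whose atoms are the `H_L`-translates). [folklore] -/
theorem stub_axialDefectCertificate :
    ∀ (N L : ℕ), 3 * N < L →
    (∀ (m : ℕ) (g : Fin m → UnitAddTorus (Fin 3) → EuclideanSpace ℝ (Fin 3))
      (P : MvPolynomial (Fin m) ℝ), (∀ i, IsBandTest N (g i)) → P.IsHomogeneous 3 →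
      (∀ a : UnitAddTorus (Fin 3), a 1 = 0 → L • a = 0 → ∀ u : Torus.energySpace (Fin 3), IsLevel N u →
        MvPolynomial.eval (fun j => Torus.pairing u.1 (fun x => g j (x + a))) P =
          MvPolynomial.eval (fun j => Torus.pairing u.1 (g j)) P) →
      (∀ u : Torus.energySpace (Fin 3), IsLevel N u →
        Torus.nsGeneratorPairing (d := Fin 3) 0 0 u (polyGrad g P u) = 0) →
      ∀ u : Torus.energySpace (Fin 3), IsLevel N u →
        MvPolynomial.eval (fun j => Torus.pairing u.1 (g j)) P = 0) →
    ∀ (ν : ℝ) (f : UnitAddTorus (Fin 3) → EuclideanSpace ℝ (Fin 3)), Torus.IsSmooth f →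
    (∀ a : UnitAddTorus (Fin 3), a 1 = 0 → ∀ x, f (x + a) = f x) →
    ∀ μ : Measure (Torus.energySpace (Fin 3)), IsProbabilityMeasure μ → (∀ᵐ u ∂μ, IsLevel N u) →
    Integrable (fun u : Torus.energySpace (Fin 3) => ‖u‖ ^ 4) μ →
    (∀ a : UnitAddTorus (Fin 3), a 1 = 0 → L • a = 0 →
      ∀ (m : ℕ) (g : Fin m → UnitAddTorus (Fin 3) → EuclideanSpace ℝ (Fin 3)),
      (∀ i, IsBandTest N (g i)) →
      Measure.map (fun u : Torus.energySpace (Fin 3) => fun i => Torus.pairing u.1 (fun x => g i (x + a))) μ =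
        Measure.map (fun u : Torus.energySpace (Fin 3) => fun i => Torus.pairing u.1 (g i)) μ) →
    ∃ (M : ℕ) (v : Fin M → Torus.energySpace (Fin 3)) (c : Fin M → ℝ),
      (∀ l, IsLevel N (v l)) ∧ (∀ l, 0 ≤ c l) ∧
      ∀ (m : ℕ) (g : Fin m → UnitAddTorus (Fin 3) → EuclideanSpace ℝ (Fin 3))
        (P : MvPolynomial (Fin m) ℝ), (∀ i, IsBandTest N (g i)) → P.IsHomogeneous 3 →
        ∫ u, Torus.nsGeneratorPairing ν f u (polyGrad g P u) ∂μ +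
          ∑ l, c l * Torus.nsGeneratorPairing (d := Fin 3) 0 0 (v l) (polyGrad g P (v l)) = 0 := by
  intro N L hL hCub ν f hf hfsym μ hμ hμN h4 hsym
  obtain ⟨n, b, hb, hbo, hbs⟩ := exists_bandBasis N
  obtain ⟨M, v, c, hvl, hc0, hcert⟩ :=
    AxialCert.exists_axialDefectCertificate_coords hb hbo hbs (by omega)
      (fun P hP hobs hcas => hCub n b P hb hP hobs hcas) ν hf hfsym μ hμN h4
      (fun a ha1 haL => hsym a ha1 haL n b hb)
  refine ⟨M, v, c, hvl, hc0, fun m g P hg hP => ?_⟩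
  -- transport the datum `(g, P)` to the coordinates of `b`
  -- adapted from Theorems/MomentParityQuarticGateDefectCertificate.lean (`stub_defectCertificate`)
  have hgb : ∀ (j : Fin m) (x : UnitAddTorus (Fin 3)),
      g j x = ∑ i, (∫ y, ⟪g j y, b i y⟫_ℝ) • b i x := fun j x => band_eq_sum_smul hbs (hg j) x
  have hpair : ∀ (u : Torus.energySpace (Fin 3)) (j : Fin m),
      Torus.pairing u.1 (g j) = ∑ i, (∫ y, ⟪g j y, b i y⟫_ℝ) * Torus.pairing u.1 (b i) :=
    fun u j => pairing_band_eq_sum hb hbs (hg j) u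
  have ht : ∀ u : Torus.energySpace (Fin 3), polyGrad g P u =
      polyGrad b (MvPolynomial.bind₁ (fun j => ∑ i, MvPolynomial.C (∫ y, ⟪g j y, b i y⟫_ℝ) *
        (MvPolynomial.X i : MvPolynomial (Fin n) ℝ)) P) u :=
    fun u => funext (polyGrad_transport (fun j i => ∫ y, ⟪g j y, b i y⟫_ℝ) hgb hpair P u)
  have h := hcert _ (isHomogeneous_bind₁_linear (fun j i => ∫ y, ⟪g j y, b i y⟫_ℝ) hP)
  simp_rw [ht]
  exact h

/-- **S3′ — axial defect certificate, `:=`-free spelling.** The statement of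
`stub_axialDefectCertificate` with the implicit dimension of `Torus.nsGeneratorPairing` pinned by a
type ascription on the zero force instead of the named argument `(d := Fin 3)` (the two statements
elaborate to the same proposition; this spelling is the one registered on the crux item as the
sub-goal `axisSectors_axialDefectCertificate`, whose registry cannot store `:=`). [folklore] -/
theorem axisSectors_axialDefectCertificate :
    ∀ (N L : ℕ), 3 * N < L →
    (∀ (m : ℕ) (g : Fin m → UnitAddTorus (Fin 3) → EuclideanSpace ℝ (Fin 3))
      (P : MvPolynomial (Fin m) ℝ), (∀ i, IsBandTest N (g i)) → P.IsHomogeneous 3 →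
      (∀ a : UnitAddTorus (Fin 3), a 1 = 0 → L • a = 0 → ∀ u : Torus.energySpace (Fin 3), IsLevel N u →
        MvPolynomial.eval (fun j => Torus.pairing u.1 (fun x => g j (x + a))) P =
          MvPolynomial.eval (fun j => Torus.pairing u.1 (g j)) P) →
      (∀ u : Torus.energySpace (Fin 3), IsLevel N u →
        Torus.nsGeneratorPairing 0 (0 : UnitAddTorus (Fin 3) → EuclideanSpace ℝ (Fin 3)) u (polyGrad g P u) = 0) →
      ∀ u : Torus.energySpace (Fin 3), IsLevel N u →
        MvPolynomial.eval (fun j => Torus.pairing u.1 (g j)) P = 0) →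
    ∀ (ν : ℝ) (f : UnitAddTorus (Fin 3) → EuclideanSpace ℝ (Fin 3)), Torus.IsSmooth f →
    (∀ a : UnitAddTorus (Fin 3), a 1 = 0 → ∀ x, f (x + a) = f x) →
    ∀ μ : Measure (Torus.energySpace (Fin 3)), IsProbabilityMeasure μ → (∀ᵐ u ∂μ, IsLevel N u) →
    Integrable (fun u : Torus.energySpace (Fin 3) => ‖u‖ ^ 4) μ →
    (∀ a : UnitAddTorus (Fin 3), a 1 = 0 → L • a = 0 →
      ∀ (m : ℕ) (g : Fin m → UnitAddTorus (Fin 3) → EuclideanSpace ℝ (Fin 3)),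
      (∀ i, IsBandTest N (g i)) →
      Measure.map (fun u : Torus.energySpace (Fin 3) => fun i => Torus.pairing u.1 (fun x => g i (x + a))) μ =
        Measure.map (fun u : Torus.energySpace (Fin 3) => fun i => Torus.pairing u.1 (g i)) μ) →
    ∃ (M : ℕ) (v : Fin M → Torus.energySpace (Fin 3)) (c : Fin M → ℝ),
      (∀ l, IsLevel N (v l)) ∧ (∀ l, 0 ≤ c l) ∧
      ∀ (m : ℕ) (g : Fin m → UnitAddTorus (Fin 3) → EuclideanSpace ℝ (Fin 3))
        (P : MvPolynomial (Fin m) ℝ), (∀ i, IsBandTest N (g i)) → P.IsHomogeneous 3 →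
        ∫ u, Torus.nsGeneratorPairing ν f u (polyGrad g P u) ∂μ +
          ∑ l, c l * Torus.nsGeneratorPairing 0 (0 : UnitAddTorus (Fin 3) → EuclideanSpace ℝ (Fin 3)) (v l) (polyGrad g P (v l)) = 0 :=
  stub_axialDefectCertificate

end Summit.AnomalousDissipation.AnomalousDissipation.Theorems.MomentParityQuarticGate
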